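import Literature.MathematicalPhysics.QuantumFieldTheory.Balaban1983to89.B9Eq315QTowerLipschitz

/-!
# `Balaban1983to89.B9Eq315QTowerLipschitzProfile` — T. Bałaban, *Propagators for lattice gauge theories in a background field*, Commun. Math. Phys.
# **99** (1985) 389–434 [Balaban1985BackgroundPropagators] (3.15)∕(3.19) p. 393 with the RUNNING small-field conditions (3.35)–(3.37) p. 396 and
# (3.78)–(3.81) p. 406: THE TOWER AVERAGING LETTERS `ρ′_k`, `δ_{Q,k}` UNDER LEVEL PROFILES — the telescoping of `B9Eq315QTowerLipschitz` with ONE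
# smallness ∕ regularity letter PER LEVEL (`ε_j`, `α_j`) instead of a uniform one: the number of levels enters ONLY through `Π_j(1 + 50(d+1)α_j)` and
# `Σ_j ε_j` (no regime hypothesis, no `2^k`), hence the SUP-currency letters are bounded INDEPENDENTLY OF `k` under geometric profiles (print's windows);
# the `L²` readings keep the sup→`L²` conversion factor `√(c₁|𝔅(T_m)|∕c₀)` (= `√|𝔅(T_{L^k m})|∕(ηL^k)` under the canonical weights — NOT `k`-free)

statement-level skeleton of published theorems with citation tags; proofs where landed; nothing here is a claim about the Yang–Mills mass gap

PDF held: `paper:balaban1985-cmp99-background-propagators` (journal page = PDF page + 388) pp. 393, 396, 403, 406; `paper:balaban1985-cmp98-averaging`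
pp. 26, 36–37 — through the tree's `B9Eq315QTowerLipschitz` ∕ `B9Eq335SmallBondsData` docstrings (verbatim there).
THE PRINT (verbatim).  (3.15) p. 393: *«Q_j(U) = Q(Ū^{j−1})…Q(Ū)Q(U)»*; p. 396, before (3.35): the conditions on the field strength of `U` are imposed
on every lattice of the sequence, *«|∂U_j| < α_j»*-type running windows ([I] (1.11)–(1.14)); p. 403: the averaging operators at `U` *«satisfy the same
bounds»* as at `U = 1`; (3.78)–(3.79) p. 406: *«Q(exp(iB)V) = Q(V) + F₂(B)»* with `F₂` small; [Balaban1985Averaging] Prop. 2 (52)–(54) p. 26: the averaged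
configurations `Ū^j` stay regular and small, LEVEL BY LEVEL.

WHY THIS FILE (cell context).  `B9Eq315QTowerLipschitz` (owner gen 83) produced the tower letters with ONE smallness letter `ε̄` for all level averages
and the regime `50(d+1)α_j ≤ 1`, giving `(2^k − 1)·102(d+1)²L·ε̄` — EXPONENTIAL in the number of levels, and fed (by `B7Eq43AveragedSmallness`) an `ε̄`
itself exponential in `k` from the level-`0` bonds.  The NE9 route file (`t4/ROUTES-NE9.md` v13.21 §L1.2, S2ᵗ) re-posed the letter in the TOWER currency:
under print's running windows the level-`j` data are geometric in the depth and the telescoped sum is `k`-free «by structure».  THIS FILE is that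
statement for the cell's typed objects: the telescoping is redone with PROFILES, keeping the factor `‖Q(Ū^j)‖ ≤ 1 + 50(d+1)α_j` (not `2`) and feeding
the level-`j` one-step modulus its own `ε_j`; §4 sums the geometric case.

WHAT IS PROVED (sorry-free; proof lane — no `def`, no `Prop` placeholder, no inequality of the papers asserted hypothesis-free).
* §1 **`norm_QprimeTower_sub_id_le_profile`**: `‖Q′_n(R)λ − Q′_n(1)λ‖_∞ ≤ (Π_{j<n}(1+ε_j)^{d(L−1)} − 1)·‖λ‖_∞` for level transporters `ε_j`-close to `1`.
* §2 **`norm_Qtower_sub_flat_apply_le_profile`**: `‖(Q_n(U)A)(c) − (Q_n(1)A)(c)‖ ≤ Π_{j<n}(1 + 50(d+1)α_j)·102(d+1)²L·(Σ_{j<n} ε_j)·sup‖A‖` — NO regime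
  hypothesis (the one-step factor norms `1 + 50(d+1)α_j` are carried as a product).
* §3 the readings at the letters of `B9Eq326OperatorTower` ∕ `B9Thm311SmallFieldCoercivityTower`: **`norm_QprimeTowerW_sub_flat_le_profile`** (the `ρ′_k`
  display: `(Π_{j≤n}(1 + 2M_φM_φ′ε_j)^{d(L−1)} − 1)·(√c₀)⁻¹`), **`norm_QkW_sub_flat_le_profile`** (the `δ_{Q,k}` display:
  `M_φ′M_φ√(c₁|𝔅(T_m)|∕c₀)·Π_{j≤n}(1 + 50(d+1)α_j)·102(d+1)²L·Σ_{j≤n}ε_j`).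
* §4 GEOMETRIC PROFILES `α_j ≤ α⋆r^j`, `ε_j ≤ ε⋆r^j` AT THE COMPOSED DEPTHS `j ≤ n`, `0 ≤ r < 1` (depth `j = 0` = the coarsest averaged field, which carries the largest deviation; `r = L^{−2}`
  for print's windows): **`norm_QkW_sub_flat_le_geometric`** (`δ_{Q,k} ≤ M_φ′M_φ√(c₁|𝔅(T_m)|∕c₀)·e^{50(d+1)α⋆∕(1−r)}·102(d+1)²L·ε⋆∕(1−r)`) and
  **`norm_QprimeTowerW_sub_flat_le_geometric`** (`ρ′_k ≤ (e^{d(L−1)·2M_φM_φ′ε⋆∕(1−r)} − 1)∕√c₀`) — both free of the number of levels `k = n+1` IN THE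
  LETTERS `(α⋆, ε⋆, r)` at FIXED `c₀, c₁, m` ([folklore] `Π(1+t_j) ≤ e^{Σt_j}`, `Σ s r^j ≤ s∕(1−r)`); see (M3) for the weight-dependent prefactors.
v1.2 (DOCFIX, doc-only; every declaration byte-identical): (M3) and the two §4 docstrings corrected on the located ASK A-2 of ne9-leaf-02 g64 (journal
l.46492; ne9-leaf-04 g74 X5 D-1 concurs): the `L²` prefactor is NOT `k`-free under the chain's canonical weights — only the sup-currency statement §2 is.
MODEL ∕ DECLARED READINGS.  (M1) as `B9Eq315QTowerLipschitz`: the per-level smallness `‖Ū^j(b) − 1‖ ≤ ε_j`, unit-boundedness `Ū^j(b) ∈ U1` and block-loop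
regularity `α_j` of the COMPOSED level averages are DISPLAYED ([Balaban1985Averaging] Prop. 2 ∕ [B9] (3.35)–(3.37) — the running small-field conditions
are AXIOMS of the `j`-th step in print ([I] (1.11)–(1.14)), NOT derived here; `B7Eq43AveragedSmallness` derives a (non-geometric) profile from level-`0`
bonds).  (M2) the depth index: `j = 0` is the factor `Q(Ū^{k−1})` (coarsest), `j = k−1` the factor `Q(U)` (finest) — `B9Eq315QTower.UlevOf`.  (M3) the
`√(c₁|𝔅(T_m)|∕c₀)` of the `L²` reading §3∕§4 is the sup-to-`L²` conversion of `B9Eq315QLipschitz.norm_WL2_le_of_pointwise` — as in gen 83.  [v1.2, located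
correction — ne9-leaf-02 g64 ASK A-2, journal l.46492:] it is `k`-free ONLY at fixed weights `c₀, c₁`; ALONG THE CHAIN's CANONICAL WEIGHTS
`c₁·(ηL^{n+1})² = c₀·L^{(n+1)d}` (every consumer: `B9Eq326OperatorTowerFlatExplicit`, `B9Thm311SmallFieldCoercivityTowerScaled`'s `C_Q`) it equals
`√|𝔅(T_{L^{n+1} m})|∕(ηL^{n+1})` — the bond count of the FINE torus, EXPONENTIAL in the number of levels — and `ρ′_k`'s `(√c₀)⁻¹` is the same sup←`L²`
price.  So: THE SUP-CURRENCY LETTER (§2 `norm_Qtower_sub_flat_apply_le_profile`) IS `k`-FREE UNDER GEOMETRIC PROFILES; THE `L²` OPERATOR LETTERS §3∕§4 ARE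
NOT — a volume-∕level-free `L²` operator bound for `Q_k(U) − Q_k(1)` needs a kernel (Schur-type) estimate using the locality of the composite averaging
(dependence domain = one big block and its κ-neighbour), NOT typed here; the (117)-currency is not touched.
HONEST SCOPE.  [folklore] telescoping of landed one-step moduli with profiles + two scalar inequalities; the profiles are DISPLAYED; the `k`-freeness of
§4 is CONDITIONAL on geometric profiles, which print supplies by its running conditions and the tree does not derive; NOT print's Lemma 3.1∕(3.37)
axial-gauge argument; NOT summit progress (cell pub-balaban: NE9 NOT PRINTED ∕ NOT PROVED; row WALLED ON A MODEL; spine PROVED 0∕9; rung (B)+1 finite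
T⁴ — NOT infinite volume, NOT mass gap, NOT Clay; HONEST DEPENDENCY: continuum YM on T⁴ ⇐ BetaPertH ∧ nine spine estimates (0/9 proved); BetaPertH ⇐
(D1) ∧ (D4) ∧ CAP+tail; G-an2-4 gates asym, D1 and NE2/3/4).  Filed by the pub-balaban NE9 BINDER-row owner lineage `b2b-balaban-t4-ne9-p1` (gen 84),
INTENT I-ne9p1-g84-3; NEW file importing `B9Eq315QTowerLipschitz` only; modifies nothing.  Net new unproved facts: 0.
-/

noncomputable section

open scoped BigOperators

namespace Literature.MathematicalPhysics.QuantumFieldTheory.Balaban1983to89.B9Eq315QTowerLipschitzProfile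

open B4Sect5Torus (TSite)
open B9SectCLatticeCarrier (Bond)
open B7Prop1Explicit (U1 Wcx boxVec)
open B9Eq311L2Pairing (WL2)
open B11Eq103H1Complex (SiteL2K BondL2K)
open B9Eq319QprimeTorus (fineP QprimeLin)
open B9Eq319QprimeLipschitz (norm_QprimeLin_sub_flat_le pi_norm_le_WL2_norm)
open B9Eq315QTorus (perSite perCfg perCfg_apply cornerSite QtorusLin QtorusLin_apply)
open B9Eq315QLipschitz (norm_QtorusLin_sub_flat_le norm_apply_le_of_WL2 norm_WL2_le_of_pointwise)
open B9Eq315QTower (towerP UlevOf Qtower Qtower_succ QkOfU QprimeTower QprimeTower_succ)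
open B9Eq315QTowerFlat (UlevOf_one perCfg_UlevOf_one_mem_U1 norm_Wcx_UlevOf_one_sub_one_le)
open B9Eq315QTowerLipschitz (norm_QprimeLin_le norm_QtorusLin_apply_le QtorusLin_apply_eq_of_eq norm_QprimeTower_id_le norm_Qtower_flat_apply_le)
open B9Eq326OperatorTower (QprimeTowerW QkW)
open B9Eq310HessianOperator (adTransportW)
open B5Eq172HodgePositivity (adTransportW_one)
open B9Eq384RemainderLetters (norm_adTransportW_sub_le)

variable {d : ℕ} (L : ℕ) [NeZero L]

/-- A product of reals `≥ 1` is `≥ 1`. [folklore] -/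
private theorem one_le_prod_range (q : ℕ → ℝ) (hq : ∀ j, 1 ≤ q j) : ∀ n : ℕ, (1 : ℝ) ≤ ∏ j ∈ Finset.range n, q j
  | 0 => by simp
  | n + 1 => by
    rw [Finset.prod_range_succ]
    have h1 := one_le_prod_range q hq n
    have h2 := hq n
    nlinarith

/-! ## §1 `Q′_n(R)` against `Q′_n(1)` under a LEVEL PROFILE of transporter defects -/

section TowerPrime

variable (m : Fin d → ℕ) [∀ i, NeZero (m i)] {V : Type*} [NormedAddCommGroup V] [NormedSpace ℂ V]

omit [∀ i, NeZero (m i)] in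
/-- **`Q′_n(R)` AGAINST `Q′_n(1)` ALONG THE TOWER, LEVEL BY LEVEL**: for a level family of bond transporters, the level-`j` ones `ε_j`-close to the
identity, `‖Q′_n(R)λ − Q′_n(1)λ‖_∞ ≤ (Π_{j<n}(1+ε_j)^{d(L−1)} − 1)·‖λ‖_∞` — the telescoping of `B9Eq315QTowerLipschitz.norm_QprimeTower_sub_id_le` with the
uniform `ε` replaced by the PROFILE `(ε_j)` (print's running small-field conditions (3.35)–(3.37), one per level).
[cite: Balaban1985BackgroundPropagators, (3.19) p.393, (3.35)–(3.37) p.396, p.403, (3.79)–(3.81) p.406] -/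
theorem norm_QprimeTower_sub_id_le_profile (Rlev : (n : ℕ) → Bond d (towerP L m (n + 1)) → V →ₗ[ℂ] V) (ε : ℕ → ℝ) (hε : ∀ n, 0 ≤ ε n)
    (hR : ∀ n b v, ‖Rlev n b v - v‖ ≤ ε n * ‖v‖) :
    ∀ (n : ℕ) (l : TSite d (towerP L m n) → V),
      ‖QprimeTower L m Rlev n l - QprimeTower L m (fun _ _ => (LinearMap.id : V →ₗ[ℂ] V)) n l‖ ≤
        ((∏ j ∈ Finset.range n, (1 + ε j) ^ (d * (L - 1))) - 1) * ‖l‖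
  | 0, l => by simp
  | n + 1, l => by
    have hq1 : ∀ j, (1 : ℝ) ≤ (1 + ε j) ^ (d * (L - 1)) := fun j => one_le_pow₀ (by linarith [hε j])
    have hPn : (1 : ℝ) ≤ ∏ j ∈ Finset.range n, (1 + ε j) ^ (d * (L - 1)) := one_le_prod_range _ hq1 n
    have hrn : (0 : ℝ) ≤ (∏ j ∈ Finset.range n, (1 + ε j) ^ (d * (L - 1))) - 1 := sub_nonneg.2 hPn
    show ‖QprimeTower L m Rlev n (QprimeLin L (towerP L m n) (Rlev n) l) -
        QprimeTower L m (fun _ _ => (LinearMap.id : V →ₗ[ℂ] V)) n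
          (QprimeLin L (towerP L m n) (fun _ : Bond d (fineP L (towerP L m n)) => (LinearMap.id : V →ₗ[ℂ] V)) l)‖ ≤ _
    set x := QprimeLin L (towerP L m n) (Rlev n) l with hx
    set y := QprimeLin L (towerP L m n) (fun _ : Bond d (fineP L (towerP L m n)) => (LinearMap.id : V →ₗ[ℂ] V)) l with hy
    have hsplit : QprimeTower L m Rlev n x - QprimeTower L m (fun _ _ => (LinearMap.id : V →ₗ[ℂ] V)) n y =
        (QprimeTower L m Rlev n x - QprimeTower L m (fun _ _ => (LinearMap.id : V →ₗ[ℂ] V)) n x) +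
          QprimeTower L m (fun _ _ => (LinearMap.id : V →ₗ[ℂ] V)) n (x - y) := by
      rw [map_sub]; abel
    have h1 := norm_QprimeTower_sub_id_le_profile Rlev ε hε hR n x
    have hxn : ‖x‖ ≤ (1 + ε n) ^ (d * (L - 1)) * ‖l‖ := norm_QprimeLin_le L (towerP L m n) (Rlev n) (hε n) (hR n) l
    have h2 := norm_QprimeTower_id_le L m n (x - y)
    have hxy : ‖x - y‖ ≤ ((1 + ε n) ^ (d * (L - 1)) - 1) * ‖l‖ := norm_QprimeLin_sub_flat_le L (towerP L m n) (Rlev n) (hε n) (hR n) l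
    calc ‖QprimeTower L m Rlev n x - QprimeTower L m (fun _ _ => (LinearMap.id : V →ₗ[ℂ] V)) n y‖
        ≤ ‖QprimeTower L m Rlev n x - QprimeTower L m (fun _ _ => (LinearMap.id : V →ₗ[ℂ] V)) n x‖ +
            ‖QprimeTower L m (fun _ _ => (LinearMap.id : V →ₗ[ℂ] V)) n (x - y)‖ := by rw [hsplit]; exact norm_add_le _ _
      _ ≤ ((∏ j ∈ Finset.range n, (1 + ε j) ^ (d * (L - 1))) - 1) * ((1 + ε n) ^ (d * (L - 1)) * ‖l‖) +
            ((1 + ε n) ^ (d * (L - 1)) - 1) * ‖l‖ := add_le_add (h1.trans (mul_le_mul_of_nonneg_left hxn hrn)) (h2.trans hxy)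
      _ = ((∏ j ∈ Finset.range (n + 1), (1 + ε j) ^ (d * (L - 1))) - 1) * ‖l‖ := by rw [Finset.prod_range_succ]; ring

end TowerPrime

/-! ## §2 `Q_n(U)` against `Q_n(1)` under LEVEL PROFILES of block-loop regularity and of bond smallness -/

section TowerQ

variable {𝔸 : Type*} [NormedRing 𝔸] [NormedAlgebra ℂ 𝔸] [CompleteSpace 𝔸] [NormOneClass 𝔸]
  (m : Fin d → ℕ) [∀ i, NeZero (m i)] (hL : 1 ≤ L) (k : ℕ) (U : Bond d (towerP L m k) → 𝔸ˣ)
  (α : ℕ → ℝ) (hα1 : ∀ j, α j ≤ 1 / 64)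
  (hU1 : ∀ (j : ℕ) (x : B7Prop1Explicit.Site d) (κ : Fin d), perCfg (towerP L m (j + 1)) (UlevOf L m k U j) x κ ∈ U1 𝔸)
  (hreg : ∀ (j : ℕ) (y : TSite d (towerP L m j)) (κ : Fin d) (r : Fin d → Fin L),
    ‖((Wcx L (perCfg (towerP L m (j + 1)) (UlevOf L m k U j)) (cornerSite L y) κ (boxVec L r) : 𝔸ˣ) : 𝔸) - 1‖ ≤ α j)
  (εU : ℕ → ℝ) (hεU : ∀ j, 0 ≤ εU j) (hUε : ∀ (j : ℕ) (b : Bond d (towerP L m (j + 1))), ‖(UlevOf L m k U j b : 𝔸) - 1‖ ≤ εU j)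

include hεU hUε in
/-- **`Q_n(U)` AGAINST `Q_n(1)` ALONG THE TOWER UNDER LEVEL PROFILES, per coarse bond**: if the level average `Ū^j` composed at depth `j` has bond
variables `ε_j`-close to `1` and `α_j`-regular block loops, then `‖(Q_n(U)A)(c) − (Q_n(1)A)(c)‖ ≤ Π_{j<n}(1 + 50(d+1)α_j) · 102(d+1)²L · (Σ_{j<n} ε_j) ·
sup‖A‖` — the telescoping `Q_{n+1}(U) − Q_{n+1}(1) = [Q_n(U) − Q_n(1)]Q(Ū^n) + Q_n(1)[Q(Ū^n) − Q(1)]` of `B9Eq315QTowerLipschitz.norm_Qtower_sub_flat_apply_le`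
with the factor `‖Q(Ū^n)‖ ≤ 1 + 50(d+1)α_n` KEPT (not rounded to `2`) and the one-step modulus at level `n` fed `ε_n` (not a uniform `ε̄`): NO regime
hypothesis, and the number of levels enters ONLY through `Π_j(1 + 50(d+1)α_j)` and `Σ_j ε_j` — bounded, hence `k`-free, under geometric profiles (§4).
[cite: Balaban1985BackgroundPropagators, (3.15) p.393, (3.35)–(3.37) p.396, (3.78)–(3.79) p.406; Balaban1985Averaging, (124)–(127) pp.36–37, Prop. 2 (52)–(54) p.26] -/
theorem norm_Qtower_sub_flat_apply_le_profile : ∀ (n : ℕ) (A : Bond d (towerP L m n) → 𝔸) {a : ℝ}, 0 ≤ a → (∀ b, ‖A b‖ ≤ a) → ∀ c : Bond d m,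
    ‖Qtower L m hL (UlevOf L m k U) α hα1 hU1 hreg n A c -
      Qtower L m hL (UlevOf L m k (fun _ : Bond d (towerP L m k) => (1 : 𝔸ˣ))) (fun _ => 0) (fun _ => by norm_num)
        (perCfg_UlevOf_one_mem_U1 L m k) (norm_Wcx_UlevOf_one_sub_one_le L m k (fun _ => 0) (fun _ => le_rfl)) n A c‖ ≤
      (∏ j ∈ Finset.range n, (1 + 50 * (d + 1) * α j)) * (102 * (d + 1) ^ 2 * L) * (∑ j ∈ Finset.range n, εU j) * a
  | 0, A, a, _, _, c => by simp
  | n + 1, A, a, ha, hA, c => by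
    have hθ : (0 : ℝ) ≤ 102 * (d + 1) ^ 2 * L := by positivity
    -- every level's regularity letter is nonnegative (it bounds a norm at the block loop based at the origin)
    have y0 : ∀ j, TSite d (towerP L m j) := fun j i => ⟨0, Nat.pos_of_ne_zero (NeZero.ne _)⟩
    have hα0 : ∀ j, 0 ≤ α j := fun j => (norm_nonneg _).trans (hreg j (y0 j) c.2 fun _ => 0)
    have hq1 : ∀ j, (1 : ℝ) ≤ 1 + 50 * (d + 1) * α j := fun j => by nlinarith [hα0 j]
    have hP1n : (1 : ℝ) ≤ ∏ j ∈ Finset.range n, (1 + 50 * (d + 1) * α j) := one_le_prod_range _ hq1 n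
    have hSn : (0 : ℝ) ≤ ∑ j ∈ Finset.range n, εU j := Finset.sum_nonneg fun j _ => hεU j
    have hεn : 0 ≤ εU n := hεU n
    -- the generic telescoping step: `x` = the level-`n` image at `U`, `y` = at the flat background
    have key : ∀ x y : Bond d (towerP L m n) → 𝔸, (∀ b, ‖x b‖ ≤ (1 + 50 * (d + 1) * α n) * a) →
        (∀ b, ‖x b - y b‖ ≤ 102 * (d + 1) ^ 2 * L * εU n * a) →
        ‖Qtower L m hL (UlevOf L m k U) α hα1 hU1 hreg n x c -
          Qtower L m hL (UlevOf L m k (fun _ : Bond d (towerP L m k) => (1 : 𝔸ˣ))) (fun _ => 0) (fun _ => by norm_num)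
            (perCfg_UlevOf_one_mem_U1 L m k) (norm_Wcx_UlevOf_one_sub_one_le L m k (fun _ => 0) (fun _ => le_rfl)) n y c‖ ≤
          (∏ j ∈ Finset.range (n + 1), (1 + 50 * (d + 1) * α j)) * (102 * (d + 1) ^ 2 * L) * (∑ j ∈ Finset.range (n + 1), εU j) * a := by
      intro x y hxb hxyb
      have hsplit : Qtower L m hL (UlevOf L m k U) α hα1 hU1 hreg n x c -
          Qtower L m hL (UlevOf L m k (fun _ : Bond d (towerP L m k) => (1 : 𝔸ˣ))) (fun _ => 0) (fun _ => by norm_num)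
            (perCfg_UlevOf_one_mem_U1 L m k) (norm_Wcx_UlevOf_one_sub_one_le L m k (fun _ => 0) (fun _ => le_rfl)) n y c =
          (Qtower L m hL (UlevOf L m k U) α hα1 hU1 hreg n x c -
            Qtower L m hL (UlevOf L m k (fun _ : Bond d (towerP L m k) => (1 : 𝔸ˣ))) (fun _ => 0) (fun _ => by norm_num)
              (perCfg_UlevOf_one_mem_U1 L m k) (norm_Wcx_UlevOf_one_sub_one_le L m k (fun _ => 0) (fun _ => le_rfl)) n x c) +
          Qtower L m hL (UlevOf L m k (fun _ : Bond d (towerP L m k) => (1 : 𝔸ˣ))) (fun _ => 0) (fun _ => by norm_num)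
            (perCfg_UlevOf_one_mem_U1 L m k) (norm_Wcx_UlevOf_one_sub_one_le L m k (fun _ => 0) (fun _ => le_rfl)) n (x - y) c := by
        rw [map_sub, Pi.sub_apply]; abel
      have ha' : (0 : ℝ) ≤ (1 + 50 * (d + 1) * α n) * a := mul_nonneg (by linarith [hq1 n]) ha
      have h1 := norm_Qtower_sub_flat_apply_le_profile n x ha' hxb c
      have h2 := norm_Qtower_flat_apply_le L m hL k n (x - y) (by positivity : (0 : ℝ) ≤ 102 * (d + 1) ^ 2 * L * εU n * a)
        (fun b => by rw [Pi.sub_apply]; exact hxyb b) c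
      have hP1 : (1 : ℝ) ≤ ∏ j ∈ Finset.range (n + 1), (1 + 50 * (d + 1) * α j) := one_le_prod_range _ hq1 (n + 1)
      have hrn : (0 : ℝ) ≤ (∏ j ∈ Finset.range n, (1 + 50 * (d + 1) * α j)) - 1 := sub_nonneg.2 hP1n
      calc _ ≤ ‖Qtower L m hL (UlevOf L m k U) α hα1 hU1 hreg n x c -
            Qtower L m hL (UlevOf L m k (fun _ : Bond d (towerP L m k) => (1 : 𝔸ˣ))) (fun _ => 0) (fun _ => by norm_num)
              (perCfg_UlevOf_one_mem_U1 L m k) (norm_Wcx_UlevOf_one_sub_one_le L m k (fun _ => 0) (fun _ => le_rfl)) n x c‖ +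
            ‖Qtower L m hL (UlevOf L m k (fun _ : Bond d (towerP L m k) => (1 : 𝔸ˣ))) (fun _ => 0) (fun _ => by norm_num)
              (perCfg_UlevOf_one_mem_U1 L m k) (norm_Wcx_UlevOf_one_sub_one_le L m k (fun _ => 0) (fun _ => le_rfl)) n (x - y) c‖ := by
            rw [hsplit]; exact norm_add_le _ _
        _ ≤ (∏ j ∈ Finset.range n, (1 + 50 * (d + 1) * α j)) * (102 * (d + 1) ^ 2 * L) * (∑ j ∈ Finset.range n, εU j) *
              ((1 + 50 * (d + 1) * α n) * a) + 102 * (d + 1) ^ 2 * L * εU n * a := add_le_add h1 h2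
        _ = (∏ j ∈ Finset.range (n + 1), (1 + 50 * (d + 1) * α j)) * (102 * (d + 1) ^ 2 * L) * (∑ j ∈ Finset.range n, εU j) * a +
              1 * (102 * (d + 1) ^ 2 * L) * εU n * a := by rw [Finset.prod_range_succ]; ring
        _ ≤ (∏ j ∈ Finset.range (n + 1), (1 + 50 * (d + 1) * α j)) * (102 * (d + 1) ^ 2 * L) * (∑ j ∈ Finset.range n, εU j) * a +
              (∏ j ∈ Finset.range (n + 1), (1 + 50 * (d + 1) * α j)) * (102 * (d + 1) ^ 2 * L) * εU n * a := by
            gcongr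
        _ = (∏ j ∈ Finset.range (n + 1), (1 + 50 * (d + 1) * α j)) * (102 * (d + 1) ^ 2 * L) * (∑ j ∈ Finset.range (n + 1), εU j) * a := by
            rw [Finset.sum_range_succ]; ring
    -- the flat factor at level `n` IS the one-step flat averaging (its background is `1` by `UlevOf_one`)
    have hy1 : ∀ b, QtorusLin L (towerP L m n) hL (UlevOf L m k (fun _ : Bond d (towerP L m k) => (1 : 𝔸ˣ)) n) (by norm_num)
        (perCfg_UlevOf_one_mem_U1 L m k n) (norm_Wcx_UlevOf_one_sub_one_le L m k (fun _ => 0) (fun _ => le_rfl) n) A b =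
        QtorusLin L (towerP L m n) hL (fun _ : Bond d (fineP L (towerP L m n)) => (1 : 𝔸ˣ)) (show (0 : ℝ) ≤ 1 / 64 by norm_num)
        (B5Eq172FlatCoercivity.hU1_one L (towerP L m n)) (B5Eq172FlatCoercivity.hreg_one L (towerP L m n)) A b :=
      QtorusLin_apply_eq_of_eq L (towerP L m n) hL _ _ _ _ (UlevOf_one L m k n) _ _ _ A
    refine key _ _ (fun b => ?_) (fun b => ?_)
    · exact norm_QtorusLin_apply_le L (towerP L m n) hL _ _ _ _ A ha hA b
    · have e := congrArg (fun t : 𝔸 => ‖QtorusLin L (towerP L m n) hL (UlevOf L m k U n) (hα1 n) (hU1 n) (hreg n) A b - t‖) (hy1 b)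
      have h : ‖QtorusLin L (towerP L m n) hL (UlevOf L m k U n) (hα1 n) (hU1 n) (hreg n) A b -
          QtorusLin L (towerP L m n) hL (fun _ : Bond d (fineP L (towerP L m n)) => (1 : 𝔸ˣ)) (show (0 : ℝ) ≤ 1 / 64 by norm_num)
            (B5Eq172FlatCoercivity.hU1_one L (towerP L m n)) (B5Eq172FlatCoercivity.hreg_one L (towerP L m n)) A b‖ ≤
          102 * (d + 1) ^ 2 * L * εU n * a :=
        norm_QtorusLin_sub_flat_le L (towerP L m n) hL _ _ _ _ (show (0 : ℝ) ≤ 1 / 64 by norm_num)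
          (B5Eq172FlatCoercivity.hU1_one L (towerP L m n)) (B5Eq172FlatCoercivity.hreg_one L (towerP L m n)) (hεU n) (fun b' => hUε n b') A hA b
      exact e.trans_le h

end TowerQ

/-! ## §3 The readings at the tower letters of `B9Eq326OperatorTower` under level profiles -/

section Readings

variable {𝔸 : Type*} [NormedRing 𝔸] [NormedAlgebra ℂ 𝔸] [CompleteSpace 𝔸] [NormOneClass 𝔸]
  (m : Fin d → ℕ) [∀ i, NeZero (m i)] (n : ℕ) (hL : 1 ≤ L)
  {W : Type*} [NormedAddCommGroup W] [InnerProductSpace ℂ W] (φ : W ≃ₗ[ℂ] 𝔸) {Mφ Mφ' : ℝ} (hMφ : 0 ≤ Mφ) (hMφ' : 0 ≤ Mφ')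
  (hφ : ∀ w, ‖φ w‖ ≤ Mφ * ‖w‖) (hφ' : ∀ X, ‖φ.symm X‖ ≤ Mφ' * ‖X‖) {c₀ c₁ : ℝ} [Fact (0 < c₀)] [Fact (0 < c₁)]
  (U : Bond d (towerP L m (n + 1)) → 𝔸ˣ) (α : ℕ → ℝ) (hα1 : ∀ j, α j ≤ 1 / 64)
  (hU1 : ∀ (j : ℕ) (x : B7Prop1Explicit.Site d) (κ : Fin d), perCfg (towerP L m (j + 1)) (UlevOf L m (n + 1) U j) x κ ∈ U1 𝔸)
  (hreg : ∀ (j : ℕ) (y : TSite d (towerP L m j)) (κ : Fin d) (r : Fin d → Fin L),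
    ‖((Wcx L (perCfg (towerP L m (j + 1)) (UlevOf L m (n + 1) U j)) (cornerSite L y) κ (boxVec L r) : 𝔸ˣ) : 𝔸) - 1‖ ≤ α j)
  (εU : ℕ → ℝ) (hεU : ∀ j, 0 ≤ εU j)
  (hUε : ∀ (j : ℕ) (b : Bond d (towerP L m (j + 1))), ‖(UlevOf L m (n + 1) U j b : 𝔸) - 1‖ ≤ εU j)
  (hUb : ∀ (j : ℕ) (b : Bond d (towerP L m (j + 1))), UlevOf L m (n + 1) U j b ∈ U1 𝔸)

include hφ hφ' hMφ hMφ' hεU hUε hUb in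
/-- **THE TOWER LETTER `ρ′_k` UNDER A LEVEL PROFILE**: `‖Q′_k(U)λ − Q′_k(1)λ‖_∞ ≤ (Π_{j≤n}(1 + 2M_φM_φ′ε_j)^{d(L−1)} − 1)·(√c₀)⁻¹·‖λ‖_{L²}` — the display
`hQ'` of `B9Thm311SmallFieldCoercivityTower` fed level by level (the transporters `R(Ū^j(b))` are `2M_φM_φ′ε_j`-close to the identity,
`norm_adTransportW_sub_le`). [cite: Balaban1985BackgroundPropagators, (3.19) p.393, (3.35)–(3.37) p.396, (3.79)–(3.81) p.406; Balaban1985Averaging, Prop. 2 (52)–(54) p.26] -/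
theorem norm_QprimeTowerW_sub_flat_le_profile (l : SiteL2K ℂ d (towerP L m (n + 1)) c₀ W) :
    ‖QprimeTowerW L m n φ U (c₀ := c₀) l - QprimeTowerW L m n φ (fun _ : Bond d (towerP L m (n + 1)) => (1 : 𝔸ˣ)) (c₀ := c₀) l‖ ≤
      ((∏ j ∈ Finset.range (n + 1), (1 + 2 * Mφ * Mφ' * εU j) ^ (d * (L - 1))) - 1) * ((Real.sqrt c₀)⁻¹ * ‖l‖) := by
  have hε : ∀ j, 0 ≤ 2 * Mφ * Mφ' * εU j := fun j => by have := hεU j; positivity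
  have hR : ∀ (j : ℕ) (b : Bond d (towerP L m (j + 1))) (v : W),
      ‖adTransportW φ (UlevOf L m (n + 1) U j) b v - v‖ ≤ 2 * Mφ * Mφ' * εU j * ‖v‖ :=
    fun j b v => norm_adTransportW_sub_le φ hφ hφ' hMφ' _ b (hUb j b) (hUε j b) v
  have hflat : (fun j => adTransportW φ (UlevOf L m (n + 1) (fun _ : Bond d (towerP L m (n + 1)) => (1 : 𝔸ˣ)) j)) =
      fun _ _ => (LinearMap.id : W →ₗ[ℂ] W) := by
    funext j b; rw [UlevOf_one, adTransportW_one]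
  have h := norm_QprimeTower_sub_id_le_profile L m (fun j => adTransportW φ (UlevOf L m (n + 1) U j)) (fun j => 2 * Mφ * Mφ' * εU j) hε hR (n + 1)
    (WL2.linearEquiv ℂ ℂ (fun _ : TSite d (towerP L m (n + 1)) => c₀) l)
  have hr : (0 : ℝ) ≤ (∏ j ∈ Finset.range (n + 1), (1 + 2 * Mφ * Mφ' * εU j) ^ (d * (L - 1))) - 1 :=
    sub_nonneg.2 (one_le_prod_range _ (fun j => one_le_pow₀ (by linarith [hε j])) (n + 1))
  rw [QprimeTowerW, QprimeTowerW, hflat, LinearMap.comp_apply, LinearMap.comp_apply, LinearEquiv.coe_toLinearMap]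
  exact h.trans (mul_le_mul_of_nonneg_left (pi_norm_le_WL2_norm L (towerP L m n) l) hr)

include hφ hφ' hMφ hMφ' hεU hUε in
/-- **THE TOWER LETTER `δ_{Q,k}` UNDER LEVEL PROFILES**: `‖Q_k(U)f − Q_k(1)f‖_{L²} ≤ M_φ′M_φ·√(c₁|𝔅(T_m)|∕c₀)·Π_{j≤n}(1 + 50(d+1)α_j)·102(d+1)²L·(Σ_{j≤n} ε_j)·‖f‖_{L²}`
— the display `hQ` of `B9Thm311SmallFieldCoercivityTower`, with NO regime hypothesis and the number of levels entering only through the profile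
product and sum (`α_j ≥ 0` displayed). [cite: Balaban1985BackgroundPropagators, (3.15)–(3.16) p.393, (3.35)–(3.37) p.396, (3.78)–(3.79) p.406; Balaban1985Averaging, (124)–(127) pp.36–37, Prop. 2 (52)–(54) p.26] -/
theorem norm_QkW_sub_flat_le_profile (hα0 : ∀ j, 0 ≤ α j) (f : BondL2K ℂ d (towerP L m (n + 1)) c₀ W) :
    ‖QkW L m n φ U hL α hα1 hU1 hreg (c₀ := c₀) (c₁ := c₁) f -
        QkW L m n φ (fun _ : Bond d (towerP L m (n + 1)) => (1 : 𝔸ˣ)) hL (fun _ => 0) (fun _ => by norm_num)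
          (perCfg_UlevOf_one_mem_U1 L m (n + 1)) (norm_Wcx_UlevOf_one_sub_one_le L m (n + 1) (fun _ => 0) (fun _ => le_rfl)) (c₀ := c₀) (c₁ := c₁) f‖ ≤
      Mφ' * Mφ * Real.sqrt (c₁ * Fintype.card (Bond d m) / c₀) *
        ((∏ j ∈ Finset.range (n + 1), (1 + 50 * (d + 1) * α j)) * (102 * (d + 1) ^ 2 * L) * (∑ j ∈ Finset.range (n + 1), εU j)) * ‖f‖ := by
  have hc₀ : 0 < c₀ := Fact.out
  set g : Bond d (towerP L m (n + 1)) → 𝔸 := fun b => φ (WL2.equiv ℂ _ W f b) with hg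
  set a : ℝ := Mφ * (‖f‖ / Real.sqrt c₀) with ha_def
  have ha0 : 0 ≤ a := mul_nonneg hMφ (div_nonneg (norm_nonneg f) (Real.sqrt_nonneg _))
  have ha : ∀ b, ‖g b‖ ≤ a := fun b => (hφ _).trans (mul_le_mul_of_nonneg_left (norm_apply_le_of_WL2 f b) hMφ)
  have hP0 : (0 : ℝ) ≤ ∏ j ∈ Finset.range (n + 1), (1 + 50 * (d + 1) * α j) :=
    Finset.prod_nonneg fun j _ => by have := hα0 j; positivity
  have hS0 : (0 : ℝ) ≤ ∑ j ∈ Finset.range (n + 1), εU j := Finset.sum_nonneg fun j _ => hεU j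
  have hpt : ∀ c : Bond d m,
      ‖WL2.equiv ℂ _ W (QkW L m n φ U hL α hα1 hU1 hreg (c₀ := c₀) (c₁ := c₁) f -
          QkW L m n φ (fun _ : Bond d (towerP L m (n + 1)) => (1 : 𝔸ˣ)) hL (fun _ => 0) (fun _ => by norm_num)
            (perCfg_UlevOf_one_mem_U1 L m (n + 1)) (norm_Wcx_UlevOf_one_sub_one_le L m (n + 1) (fun _ => 0) (fun _ => le_rfl))
            (c₀ := c₀) (c₁ := c₁) f) c‖ ≤
        Mφ' * ((∏ j ∈ Finset.range (n + 1), (1 + 50 * (d + 1) * α j)) * (102 * (d + 1) ^ 2 * L) * (∑ j ∈ Finset.range (n + 1), εU j) * a) := by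
    intro c
    rw [WL2.equiv_sub, Pi.sub_apply]
    show ‖φ.symm (QkOfU L m hL (n + 1) U α hα1 hU1 hreg g c) -
        φ.symm (QkOfU L m hL (n + 1) (fun _ : Bond d (towerP L m (n + 1)) => (1 : 𝔸ˣ)) (fun _ => 0) (fun _ => by norm_num)
          (perCfg_UlevOf_one_mem_U1 L m (n + 1)) (norm_Wcx_UlevOf_one_sub_one_le L m (n + 1) (fun _ => 0) (fun _ => le_rfl)) g c)‖ ≤ _
    rw [← map_sub]
    exact (hφ' _).trans (mul_le_mul_of_nonneg_left
      (norm_Qtower_sub_flat_apply_le_profile L m hL (n + 1) U α hα1 hU1 hreg εU hεU hUε (n + 1) g ha0 ha c) hMφ')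
  have hB0 : 0 ≤ Mφ' * ((∏ j ∈ Finset.range (n + 1), (1 + 50 * (d + 1) * α j)) * (102 * (d + 1) ^ 2 * L) *
      (∑ j ∈ Finset.range (n + 1), εU j) * a) := by positivity
  refine (norm_WL2_le_of_pointwise _ hB0 hpt).trans (le_of_eq ?_)
  rw [ha_def, Real.sqrt_div' _ hc₀.le]
  ring

end Readings

/-! ## §4 Geometric profiles (print's running windows): the tower letters are bounded INDEPENDENTLY of the number of levels -/

section Geometric

/-- `Π_{j<n}(1 + t_j) ≤ exp(Σ_{j<n} t_j)` for `t_j ≥ 0`. [folklore] -/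
private theorem prod_one_add_le_exp_sum (t : ℕ → ℝ) (ht : ∀ j, 0 ≤ t j) (n : ℕ) :
    ∏ j ∈ Finset.range n, (1 + t j) ≤ Real.exp (∑ j ∈ Finset.range n, t j) := by
  rw [Real.exp_sum]
  exact Finset.prod_le_prod (fun j _ => by linarith [ht j]) fun j _ => by linarith [Real.add_one_le_exp (t j)]

/-- `Σ_{j<n} s·r^j ≤ s∕(1−r)` for `0 ≤ r < 1`, `0 ≤ s`. [folklore] -/
private theorem sum_geometric_le (s r : ℝ) (hs : 0 ≤ s) (hr0 : 0 ≤ r) (hr1 : r < 1) (n : ℕ) :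
    ∑ j ∈ Finset.range n, s * r ^ j ≤ s / (1 - r) := by
  rw [← Finset.mul_sum, div_eq_mul_one_div]
  refine mul_le_mul_of_nonneg_left ?_ hs
  have h := geom_sum_Ico_le_of_lt_one (m := 0) (n := n) hr0 hr1
  rw [pow_zero] at h
  rwa [Finset.range_eq_Ico]

/-- Monotonicity of a profile product in the profile (only the composed levels `j < n` matter). [folklore] -/
private theorem prod_range_mono {t t' : ℕ → ℝ} (ht : ∀ j, 0 ≤ t j) (n : ℕ) (htt' : ∀ j < n, t j ≤ t' j) :
    ∏ j ∈ Finset.range n, (1 + t j) ≤ ∏ j ∈ Finset.range n, (1 + t' j) :=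
  Finset.prod_le_prod (fun j _ => by linarith [ht j]) fun j hj => by linarith [htt' j (Finset.mem_range.1 hj)]

variable {𝔸 : Type*} [NormedRing 𝔸] [NormedAlgebra ℂ 𝔸] [CompleteSpace 𝔸] [NormOneClass 𝔸]
  (m : Fin d → ℕ) [∀ i, NeZero (m i)] (n : ℕ) (hL : 1 ≤ L)
  {W : Type*} [NormedAddCommGroup W] [InnerProductSpace ℂ W] (φ : W ≃ₗ[ℂ] 𝔸) {Mφ Mφ' : ℝ} (hMφ : 0 ≤ Mφ) (hMφ' : 0 ≤ Mφ')
  (hφ : ∀ w, ‖φ w‖ ≤ Mφ * ‖w‖) (hφ' : ∀ X, ‖φ.symm X‖ ≤ Mφ' * ‖X‖) {c₀ c₁ : ℝ} [Fact (0 < c₀)] [Fact (0 < c₁)]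
  (U : Bond d (towerP L m (n + 1)) → 𝔸ˣ) (α : ℕ → ℝ) (hα1 : ∀ j, α j ≤ 1 / 64)
  (hU1 : ∀ (j : ℕ) (x : B7Prop1Explicit.Site d) (κ : Fin d), perCfg (towerP L m (j + 1)) (UlevOf L m (n + 1) U j) x κ ∈ U1 𝔸)
  (hreg : ∀ (j : ℕ) (y : TSite d (towerP L m j)) (κ : Fin d) (r : Fin d → Fin L),
    ‖((Wcx L (perCfg (towerP L m (j + 1)) (UlevOf L m (n + 1) U j)) (cornerSite L y) κ (boxVec L r) : 𝔸ˣ) : 𝔸) - 1‖ ≤ α j)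
  (εU : ℕ → ℝ) (hεU : ∀ j, 0 ≤ εU j)
  (hUε : ∀ (j : ℕ) (b : Bond d (towerP L m (j + 1))), ‖(UlevOf L m (n + 1) U j b : 𝔸) - 1‖ ≤ εU j)
  (hUb : ∀ (j : ℕ) (b : Bond d (towerP L m (j + 1))), UlevOf L m (n + 1) U j b ∈ U1 𝔸)
  {r αs εs : ℝ} (hr0 : 0 ≤ r) (hr1 : r < 1) (hαs : 0 ≤ αs) (hεs : 0 ≤ εs)
  (hαg : ∀ j < n + 1, α j ≤ αs * r ^ j) (hεg : ∀ j < n + 1, εU j ≤ εs * r ^ j)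

include hφ hφ' hMφ hMφ' hεU hUε hr0 hr1 hαs hεs hαg hεg in
/-- **`δ_{Q,k}` UNDER GEOMETRIC WINDOWS IS BOUNDED INDEPENDENTLY OF THE NUMBER OF LEVELS**: if the composed level averages satisfy `α_j ≤ α⋆r^j`,
`ε_j ≤ ε⋆r^j` for the composed depths `j ≤ n` (`0 ≤ r < 1`; print's running conditions (3.35)–(3.37) read at the depths `j` — the coarse levels carry the large deviations, the fine
ones geometrically smaller; for the field-strength window `r = L^{−2}`, for the bond letters of p. 406 rather `r = L^{−1}` — any `0 ≤ r < 1` works), then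
`‖Q_k(U)f − Q_k(1)f‖_{L²} ≤ M_φ′M_φ·√(c₁|𝔅(T_m)|∕c₀)·e^{50(d+1)α⋆∕(1−r)}·102(d+1)²L·(ε⋆∕(1−r))·‖f‖_{L²}` for EVERY `k = n+1` — the re-posed S2ᵗ of the NE9 route
file «k-free by structure» IN THE LETTERS; [v1.2:] the prefactor `√(c₁|𝔅(T_m)|∕c₀)` is `√|𝔅(T_{L^{n+1}m})|∕(ηL^{n+1})` under the chain's canonical weights,
so as an `L²` OPERATOR bound this is NOT level-free (header (M3); the sup-currency §2 is). [cite: Balaban1985BackgroundPropagators, (3.15)–(3.16) p.393, (3.35)–(3.37) p.396, (3.78)–(3.79) p.406; Balaban1985Averaging, (124)–(127) pp.36–37, Prop. 2 (52)–(54) p.26] -/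
theorem norm_QkW_sub_flat_le_geometric (hα0 : ∀ j, 0 ≤ α j) (f : BondL2K ℂ d (towerP L m (n + 1)) c₀ W) :
    ‖QkW L m n φ U hL α hα1 hU1 hreg (c₀ := c₀) (c₁ := c₁) f -
        QkW L m n φ (fun _ : Bond d (towerP L m (n + 1)) => (1 : 𝔸ˣ)) hL (fun _ => 0) (fun _ => by norm_num)
          (perCfg_UlevOf_one_mem_U1 L m (n + 1)) (norm_Wcx_UlevOf_one_sub_one_le L m (n + 1) (fun _ => 0) (fun _ => le_rfl)) (c₀ := c₀) (c₁ := c₁) f‖ ≤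
      Mφ' * Mφ * Real.sqrt (c₁ * Fintype.card (Bond d m) / c₀) *
        (Real.exp (50 * (d + 1) * αs / (1 - r)) * (102 * (d + 1) ^ 2 * L) * (εs / (1 - r))) * ‖f‖ := by
  have base := norm_QkW_sub_flat_le_profile L m n hL φ hMφ hMφ' hφ hφ' (c₀ := c₀) (c₁ := c₁) U α hα1 hU1 hreg εU hεU hUε hα0 f
  have ht : ∀ j, (0 : ℝ) ≤ 50 * (d + 1) * α j := fun j => by have := hα0 j; positivity
  have htt' : ∀ j < n + 1, 50 * (d + 1) * α j ≤ 50 * (d + 1) * αs * r ^ j := fun j hj => by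
    have h := mul_le_mul_of_nonneg_left (hαg j hj) (by positivity : (0 : ℝ) ≤ 50 * (d + 1))
    linarith [h]
  have ht' : ∀ j, (0 : ℝ) ≤ 50 * (d + 1) * αs * r ^ j := fun j => by positivity
  have hP : ∏ j ∈ Finset.range (n + 1), (1 + 50 * (d + 1) * α j) ≤ Real.exp (50 * (d + 1) * αs / (1 - r)) :=
    calc ∏ j ∈ Finset.range (n + 1), (1 + 50 * (d + 1) * α j)
        ≤ ∏ j ∈ Finset.range (n + 1), (1 + 50 * (d + 1) * αs * r ^ j) := prod_range_mono ht (n + 1) htt'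
      _ ≤ Real.exp (∑ j ∈ Finset.range (n + 1), 50 * (d + 1) * αs * r ^ j) := prod_one_add_le_exp_sum _ ht' (n + 1)
      _ ≤ Real.exp (50 * (d + 1) * αs / (1 - r)) :=
          Real.exp_le_exp.2 (sum_geometric_le (50 * (d + 1) * αs) r (by positivity) hr0 hr1 (n + 1))
  have hS : ∑ j ∈ Finset.range (n + 1), εU j ≤ εs / (1 - r) :=
    (Finset.sum_le_sum fun j hj => hεg j (Finset.mem_range.1 hj)).trans (sum_geometric_le εs r hεs hr0 hr1 (n + 1))
  have hP0 : (0 : ℝ) ≤ ∏ j ∈ Finset.range (n + 1), (1 + 50 * (d + 1) * α j) := Finset.prod_nonneg fun j _ => by linarith [ht j]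
  have hS0 : (0 : ℝ) ≤ ∑ j ∈ Finset.range (n + 1), εU j := Finset.sum_nonneg fun j _ => hεU j
  refine base.trans ?_
  gcongr

include hφ hφ' hMφ hMφ' hεU hUε hUb hr0 hr1 hεs hεg in
/-- **`ρ′_k` UNDER A GEOMETRIC WINDOW IS BOUNDED INDEPENDENTLY OF THE NUMBER OF LEVELS**:
`‖Q′_k(U)λ − Q′_k(1)λ‖_∞ ≤ (e^{d(L−1)·2M_φM_φ′ε⋆∕(1−r)} − 1)·(√c₀)⁻¹·‖λ‖_{L²}` for every `k = n+1` when `ε_j ≤ ε⋆r^j` at the composed depths `j ≤ n`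
([v1.2:] level-free in the letters; the `(√c₀)⁻¹` is the sup←`L²` price, `c₀ = η^d` in print's normalisation — header (M3)).
[cite: Balaban1985BackgroundPropagators, (3.19) p.393, (3.35)–(3.37) p.396, (3.79)–(3.81) p.406; Balaban1985Averaging, Prop. 2 (52)–(54) p.26] -/
theorem norm_QprimeTowerW_sub_flat_le_geometric (l : SiteL2K ℂ d (towerP L m (n + 1)) c₀ W) :
    ‖QprimeTowerW L m n φ U (c₀ := c₀) l - QprimeTowerW L m n φ (fun _ : Bond d (towerP L m (n + 1)) => (1 : 𝔸ˣ)) (c₀ := c₀) l‖ ≤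
      (Real.exp ((d * (L - 1) : ℕ) * (2 * Mφ * Mφ' * εs / (1 - r))) - 1) * ((Real.sqrt c₀)⁻¹ * ‖l‖) := by
  have base := norm_QprimeTowerW_sub_flat_le_profile L m n φ hMφ hMφ' hφ hφ' (c₀ := c₀) U εU hεU hUε hUb l
  have ht : ∀ j, (0 : ℝ) ≤ 2 * Mφ * Mφ' * εU j := fun j => by have := hεU j; positivity
  have ht' : ∀ j, (0 : ℝ) ≤ 2 * Mφ * Mφ' * εs * r ^ j := fun j => by positivity
  have htt' : ∀ j < n + 1, 2 * Mφ * Mφ' * εU j ≤ 2 * Mφ * Mφ' * εs * r ^ j := fun j hj => by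
    have h := mul_le_mul_of_nonneg_left (hεg j hj) (by positivity : (0 : ℝ) ≤ 2 * Mφ * Mφ')
    linarith [h]
  have hP : ∏ j ∈ Finset.range (n + 1), (1 + 2 * Mφ * Mφ' * εU j) ^ (d * (L - 1)) ≤
      Real.exp ((d * (L - 1) : ℕ) * (2 * Mφ * Mφ' * εs / (1 - r))) := by
    rw [Finset.prod_pow, Real.exp_nat_mul]
    have h1 : ∏ j ∈ Finset.range (n + 1), (1 + 2 * Mφ * Mφ' * εU j) ≤ Real.exp (2 * Mφ * Mφ' * εs / (1 - r)) :=
      calc ∏ j ∈ Finset.range (n + 1), (1 + 2 * Mφ * Mφ' * εU j)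
          ≤ ∏ j ∈ Finset.range (n + 1), (1 + 2 * Mφ * Mφ' * εs * r ^ j) := prod_range_mono ht (n + 1) htt'
        _ ≤ Real.exp (∑ j ∈ Finset.range (n + 1), 2 * Mφ * Mφ' * εs * r ^ j) := prod_one_add_le_exp_sum _ ht' (n + 1)
        _ ≤ Real.exp (2 * Mφ * Mφ' * εs / (1 - r)) :=
            Real.exp_le_exp.2 (sum_geometric_le (2 * Mφ * Mφ' * εs) r (by positivity) hr0 hr1 (n + 1))
    exact pow_le_pow_left₀ (Finset.prod_nonneg fun j _ => by linarith [ht j]) h1 _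
  have hl0 : 0 ≤ (Real.sqrt c₀)⁻¹ * ‖l‖ := by positivity
  exact base.trans (mul_le_mul_of_nonneg_right (by linarith [hP]) hl0)

end Geometric

end Literature.MathematicalPhysics.QuantumFieldTheory.Balaban1983to89.B9Eq315QTowerLipschitzProfile

end
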